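import Summits.KontsevichZagierPeriods.KontsevichZagierPeriods.Theorems.LiouvilleUnfoldingAyoubPiLocalKernelNilCut
import Mathlib.RingTheory.Ideal.MinimalPrime.Localization
import Mathlib.Algebra.DualNumber

/-!
# Item stmt-KontsevichZagierPeriods-0541, line `SketchIdeator2`, stub `stub_nilLocalKernel`:
# the transcendence half on the minimal primes — "generic ∧ connected" — and independence of the halves

Support file (`--supports` stmt-KontsevichZagierPeriods-0541).  `P := KZ.FormalPeriodRing`,
`p := KZ.toFormalPeriod (KZ.of KZ.piRep)` (the disc class), (N) := `∀ x : P, evalP x = 0 → ∃ N k,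
p ^ N * x ^ (k + 1) = 0` (stub `stub_nilLocalKernel`), (R) := `(∃ N k, p ^ N * x ^ (k + 1) = 0) → ∃ N,
p ^ N * x = 0` (stub `stub_locallyReducedOnTorsion`).

1. `nilLocalKernel_iff_minimalPrimes` — (N) holds iff every MINIMAL prime of `P` avoiding `p` IS
   `ker evalP`; hence (N) splits as GENERICITY (`ker evalP` is a minimal prime of `P`: the evaluation
   point is a generic point of `Spec P`, `ker_evalP_mem_minimalPrimes_of_nilLocalKernel`) plus UNIQUENESS
   (any two minimal primes avoiding `p` coincide: `Spec P[p⁻¹]` is irreducible) —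
   `nilLocalKernel_iff_generic_and_irreducible`, the calculus-side sentence for the two clauses
   "comparison point generic" and "`X(M)` connected" of Huber–Müller-Stach's Conjecture 13.2.5.
   Genericity alone already gives the generic-point clause of the fraction-field cut: every class of
   value `0` is a zero-divisor (`exists_mul_eq_zero_of_generic`, minimal primes consist of zero-divisors).
2. `model_nil_not_locallyReduced`, `model_locallyReduced_not_nil` — over the bare interface
   (commutative ring, ring character to `ℝ`, distinguished element of non-zero value) the two halves are
   logically independent: the dual numbers `ℝ[ε]` satisfy (N) and violate (R); `ℝ × ℝ` satisfies (R) and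
   violates (N).  So a proof of either stub must use structure of the Kontsevich–Zagier calculus beyond
   this interface, and the cut loses nothing to either side.

References: A. Huber, S. Müller-Stach, *Periods and Nori Motives* (2017), Conj. 13.2.5, Rem. 13.2.4;
J. Ayoub, EMS Newsl. 91 (2014), Conj. 7.  Mathlib: `minimalPrimes`, `Ideal.exists_minimalPrimes_le`,
`Ideal.exists_mul_mem_of_mem_minimalPrimes`, `DualNumber`, `TrivSqZeroExt`.  No definition is introduced.
-/

noncomputable section

open Literature.NumberTheory.Transcendental

namespace Summit.KontsevichZagierPeriods.LiouvilleUnfolding.NilradicalCut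

open Summit.KontsevichZagierPeriods.LiouvilleUnfolding.PiLocalKernelPosition

/-! ## (N) on the minimal primes -/

/-- The disc class is not in the value-kernel (`evalP p = π ≠ 0`). [folklore] -/
theorem piClass_not_mem_ker_evalP : KZ.toFormalPeriod (KZ.of KZ.piRep) ∉ RingHom.ker KZ.evalP :=
  fun h => evalP_piClass_ne_zero (RingHom.mem_ker.mp h)

/-- **(N) ↔ every minimal prime of `P` avoiding the disc class is `ker evalP`.** `→`: a minimal prime
`q ∌ p` contains the prime `ker evalP` (prime form of (N)), hence equals it. `←`: every prime `q' ∌ p`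
contains a minimal prime `q ∌ p`, which is `ker evalP`. [cite: HuberMullerStachPeriods2017, Conj. 13.2.5] -/
theorem nilLocalKernel_iff_minimalPrimes :
    (∀ x : KZ.FormalPeriodRing, KZ.evalP x = 0 →
        ∃ N k : ℕ, KZ.toFormalPeriod (KZ.of KZ.piRep) ^ N * x ^ (k + 1) = 0) ↔
      ∀ q ∈ minimalPrimes KZ.FormalPeriodRing, KZ.toFormalPeriod (KZ.of KZ.piRep) ∉ q →
        q = RingHom.ker KZ.evalP := by
  rw [nilLocalKernel_iff_primes]
  constructor
  · intro h q hq hpq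
    have hle : RingHom.ker KZ.evalP ≤ q := h q hq.1.1 hpq
    exact le_antisymm (hq.2 ⟨RingHom.ker_isPrime _, bot_le⟩ hle) hle
  · intro h q hq hpq
    haveI := hq
    obtain ⟨q₀, hq₀, hq₀q⟩ := Ideal.exists_minimalPrimes_le (I := (⊥ : Ideal KZ.FormalPeriodRing))
      (J := q) bot_le
    have hpq₀ : KZ.toFormalPeriod (KZ.of KZ.piRep) ∉ q₀ := fun h' => hpq (hq₀q h')
    rw [← h q₀ hq₀ hpq₀]
    exact hq₀q

/-- **(N) ⇒ genericity of the evaluation point**: under (N), `ker evalP` is a minimal prime of `P`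
(a minimal prime below `ker evalP` avoids `p`, hence is `ker evalP`). [cite: HuberMullerStachPeriods2017, Conj. 13.2.5] -/
theorem ker_evalP_mem_minimalPrimes_of_nilLocalKernel
    (h : ∀ x : KZ.FormalPeriodRing, KZ.evalP x = 0 →
      ∃ N k : ℕ, KZ.toFormalPeriod (KZ.of KZ.piRep) ^ N * x ^ (k + 1) = 0) :
    RingHom.ker KZ.evalP ∈ minimalPrimes KZ.FormalPeriodRing := by
  rw [nilLocalKernel_iff_minimalPrimes] at h
  haveI : (RingHom.ker KZ.evalP).IsPrime := RingHom.ker_isPrime _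
  obtain ⟨q₀, hq₀, hq₀q⟩ := Ideal.exists_minimalPrimes_le (I := (⊥ : Ideal KZ.FormalPeriodRing))
    (J := RingHom.ker KZ.evalP) bot_le
  have hpq₀ : KZ.toFormalPeriod (KZ.of KZ.piRep) ∉ q₀ := fun h' => piClass_not_mem_ker_evalP (hq₀q h')
  rw [← h q₀ hq₀ hpq₀]
  exact hq₀

/-- **(N) ↔ generic ∧ irreducible**: (N) holds iff `ker evalP` is a minimal prime of `P` AND any two
minimal primes of `P` avoiding the disc class coincide (the spectrum of `P[p⁻¹]` has exactly one generic
point, and it is the evaluation point). [cite: HuberMullerStachPeriods2017, Conj. 13.2.5] -/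
theorem nilLocalKernel_iff_generic_and_irreducible :
    (∀ x : KZ.FormalPeriodRing, KZ.evalP x = 0 →
        ∃ N k : ℕ, KZ.toFormalPeriod (KZ.of KZ.piRep) ^ N * x ^ (k + 1) = 0) ↔
      (RingHom.ker KZ.evalP ∈ minimalPrimes KZ.FormalPeriodRing ∧
        ∀ q ∈ minimalPrimes KZ.FormalPeriodRing, ∀ q' ∈ minimalPrimes KZ.FormalPeriodRing,
          KZ.toFormalPeriod (KZ.of KZ.piRep) ∉ q → KZ.toFormalPeriod (KZ.of KZ.piRep) ∉ q' →
            q = q') := by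
  constructor
  · intro h
    refine ⟨ker_evalP_mem_minimalPrimes_of_nilLocalKernel h, fun q hq q' hq' hpq hpq' => ?_⟩
    rw [nilLocalKernel_iff_minimalPrimes] at h
    rw [h q hq hpq, h q' hq' hpq']
  · rintro ⟨hgen, huniq⟩
    rw [nilLocalKernel_iff_minimalPrimes]
    intro q hq hpq
    exact huniq q hq _ hgen hpq piClass_not_mem_ker_evalP

/-- **Genericity alone gives the generic-point clause**: if `ker evalP` is a minimal prime of `P` then
every class of value `0` is a zero-divisor (`x * y = 0` for some `y ≠ 0`), minimal primes consisting of
zero-divisors. [folklore] -/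
theorem exists_mul_eq_zero_of_generic
    (hgen : RingHom.ker KZ.evalP ∈ minimalPrimes KZ.FormalPeriodRing)
    {x : KZ.FormalPeriodRing} (hx : KZ.evalP x = 0) :
    ∃ y : KZ.FormalPeriodRing, y ≠ 0 ∧ x * y = 0 := by
  obtain ⟨y, hy, hxy⟩ := Ideal.exists_mul_mem_of_mem_minimalPrimes hgen (RingHom.mem_ker.mpr hx)
  exact ⟨y, fun h0 => hy (h0 ▸ Ideal.zero_mem _), Ideal.mem_bot.mp hxy⟩

/-! ## The two halves are independent over the bare interface -/

/-- **Model: (N) without (R).** The dual numbers `ℝ[ε]` with the character `fst` and distinguished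
element `1` satisfy the nil half (the kernel `ℝ ε` squares to `0`) and violate the locally-reduced half
(`ε` is nil but not torsion). [folklore] -/
theorem model_nil_not_locallyReduced :
    ∃ (R : Type) (_ : CommRing R) (e : R →+* ℝ) (w : R), e w ≠ 0 ∧
      (∀ x : R, e x = 0 → ∃ N k : ℕ, w ^ N * x ^ (k + 1) = 0) ∧
      ¬ (∀ x : R, (∃ N k : ℕ, w ^ N * x ^ (k + 1) = 0) → ∃ N : ℕ, w ^ N * x = 0) := by
  refine ⟨DualNumber ℝ, inferInstance, (TrivSqZeroExt.fstHom ℝ ℝ ℝ).toRingHom, 1, ?_, ?_, ?_⟩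
  · simp
  · intro x hx
    refine ⟨0, 1, ?_⟩
    have hx' : x.fst = 0 := hx
    have hxe : x = TrivSqZeroExt.inr x.snd := by
      ext <;> simp [hx']
    rw [hxe, one_pow, one_mul, pow_two, TrivSqZeroExt.inr_mul_inr]
  · intro h
    obtain ⟨N, hN⟩ := h DualNumber.eps ⟨0, 1, by rw [pow_zero, one_mul, pow_two, DualNumber.eps_mul_eps]⟩
    rw [one_pow, one_mul] at hN
    have h1 : (DualNumber.eps : DualNumber ℝ).snd = (0 : DualNumber ℝ).snd := by rw [hN]
    simp at h1

/-- **Model: (R) without (N).** `ℝ × ℝ` with the character `fst` and distinguished element `1` is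
reduced (so satisfies the locally-reduced half) and violates the nil half (`(0, 1)` has value `0` and is
not nilpotent). [folklore] -/
theorem model_locallyReduced_not_nil :
    ∃ (R : Type) (_ : CommRing R) (e : R →+* ℝ) (w : R), e w ≠ 0 ∧
      (∀ x : R, (∃ N k : ℕ, w ^ N * x ^ (k + 1) = 0) → ∃ N : ℕ, w ^ N * x = 0) ∧
      ¬ (∀ x : R, e x = 0 → ∃ N k : ℕ, w ^ N * x ^ (k + 1) = 0) := by
  refine ⟨ℝ × ℝ, inferInstance, RingHom.fst ℝ ℝ, 1, by simp, ?_, ?_⟩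
  · rintro x ⟨N, k, hNk⟩
    refine ⟨0, ?_⟩
    rw [one_pow, one_mul] at hNk ⊢
    exact pow_eq_zero_iff (Nat.succ_ne_zero k) |>.mp hNk
  · intro h
    obtain ⟨N, k, hNk⟩ := h (0, 1) rfl
    rw [one_pow, one_mul, Prod.ext_iff] at hNk
    simp at hNk

/-- **Registered sub-goal of the line** (`nilLocalKernel_iff_minimalPrimes_forall`): (N) ↔ every minimal
prime of `P` avoiding the disc class equals `ker evalP`, in the `∀`-form recorded on the item.
[cite: HuberMullerStachPeriods2017, Conj. 13.2.5] -/
theorem nilLocalKernel_iff_minimalPrimes_forall : (∀ x : KZ.FormalPeriodRing, KZ.evalP x = 0 → ∃ N k : ℕ, KZ.toFormalPeriod (KZ.of KZ.piRep) ^ N * x ^ (k + 1) = 0) ↔ ∀ q : Ideal KZ.FormalPeriodRing, q ∈ minimalPrimes KZ.FormalPeriodRing → KZ.toFormalPeriod (KZ.of KZ.piRep) ∉ q → q = RingHom.ker KZ.evalP :=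
  nilLocalKernel_iff_minimalPrimes

end Summit.KontsevichZagierPeriods.LiouvilleUnfolding.NilradicalCut

end
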